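import Literature.NumberTheory.EllipticCurves.BurungaleCastellaSkinnerTian2022.CMPConverse
import Literature.NumberTheory.EllipticCurves.DeuringSupersingularReductionHoldsProofs
import HarnessLib

/-!
# Burungale–Castella–Skinner–Tian 2022, Theorem A — the `p = 2` SLICE and the odd-`p` part, with the split `Thm A ⟺ (Thm A at 2) ∧ (Thm A at odd p)`

HONEST FRAMING (cell `bsd-goldfeld`, typer seat `bsd-goldfeld-ty` g12; filed on the order of the
cell's planner (ruling g26 (cxv), 2026-08-27) after the citation desk's word — `pub/bsd-cited`
D-audit sheet r06/S5 `D-AUDIT-r06-S5-BCST22ThmA.md` sha16 `1830509b17241bda`, desk round C2 R631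
PASS, registry entry R-21 CONFIRMED «A140 = GAPPED-BY-CITATION (AS PRINTED) on the `p = 2` slice»,
typed repair target «T-BCST22-A@2» DESK-ENDORSED). Nothing here proves or refutes BSD or Theorem A.
This file changes NO existing declaration: it names, as two closed `Prop`s, the two halves of the
tree's cite-tagged fact `thmA_analyticRank_eq_one_of_selmerCorank_eq_one` (= "A140",
`CMPConverse.lean`) — its `p = 2` slice `ThmA_at_two` and its odd-`p` part `ThmA_odd` — and PROVES
the split `A140 ↔ ThmA_at_two ∧ ThmA_odd` (kernel bookkeeping, `by_cases p = 2`). Purpose: every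
consumer of A140 in the tree instantiates it at `p = 2` (`K = ℚ(√−7)`: the X12 corner, the Goldfeld
assemblies for the twists of `X₀(49)`, crux K12₂′ `RankOneTwoConverseCMSevenAtAnyTwo` of route
`GoldfeldAllTwistsTwoConverse`) or at `p = 3`; with the slice named, a route can consume EXACTLY the
`p = 2` statement — whose printed proof is the part the desk found gapped-by-citation — and nothing
wider (planner g26 (cxv): future by-name item `BCSTThmAAtTwo := ThmA_at_two`, glue
`K12₂″ → BCSTThmAAtTwo → K12₂′` in `Summits/…/Theorems/GoldfeldAllTwistsTwoConverseAtTwoGlue.lean`).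

WHY TWO NAMED `Prop`S AND NOT A RESTATEMENT. `ThmA_at_two` and `ThmA_odd` are each IMPLIED by the
refereed Theorem A exactly as printed (`thmA_at_two_of_thmA`, `thmA_odd_of_thmA` below) — they cite
the same theorem (p. 326) and claim nothing beyond it; they are weaker, not paraphrases dressed as
new hypotheses, and the split theorem records the exact relation to A140 in the kernel. They are
filed as separate names ONLY because the printed PROOF's status differs on the two halves (next
section), which is a distinction a single `Prop` cannot carry. No `_holds`: as for A140, a proof
needs Heegner-class Iwasawa theory absent from the tree.

## Proof status, by prime (desk sheet r06/S5 §0, §4; concordant with `CMPConverse.lean` §"Proof status at `p = 2`" and the cell's `R1-AUDIT.md`)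

Version of record: Ann. Math. Québec **46** (2022) 325–346 (publisher's PDF as deposited in
CaltechAUTHORS `1791g-a9y92`; PDF page `n` = journal page `324 + n`). The STATEMENT of Theorem A is
refereed for every prime `p` of good ordinary reduction (p. 326; abstract p. 325 "which our
approach extends to all primes"; Rem. D p. 327 discusses `p = 2` under Thm. A).
* `p ≥ 5`: first proved by Burungale–Tian, Invent. Math. 220 (2020) (tree fact
  `burungaleTian_analyticRank_eq_one_of_selmerCorank_eq_one_of_hasCM`); not at issue.
* `p = 3` (`K ∈ {ℚ(√−2), ℚ(√−11)}`): one BY-REFERENCE extension step located by the desk (E1):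
  Thm. 6.1 (i) (p. 340) "follows from [1, Thm. 2.4.17], as extended in [2, Thm. 3.9]. (In these
  references, the hypothesis `p > 3` … can be removed thanks to [31, 39].)" — Agboola–Howard 2006
  is printed under a standing "`p > 3`". Informational; not a gap as printed (desk token
  `BCST22-Thm61i-AH06-beyond-p>3-by-reference`).
* `p = 2` (`K = ℚ(√−7)`, the only class-number-one field with `2` split): E1 plus THREE inputs
  printed for ODD `p` only, with no `p = 2` extension sentence in the paper — (E2) Thm. 5.1, the
  `Λ`-adic big logarithm and explicit reciprocity law (p. 338, "follows from … Loeffler–Zerbes [33]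
  … [19, §5.3]") ← Loeffler–Zerbes IJNT 10 (2014) §2.1 "Let `p` be an odd prime", Castella–Hsieh
  Math. Ann. 370 (2018) §1 "Fix an odd prime `p ∤ N`"; (E3) Thm. 4.4 (p. 336, Katz measure
  "construction in [28]") ← Hsieh, Crelle 688 (2014) §1 "Let `p > 2`"; (E4) Thm. 7.1 (i) (p. 341,
  "follows from [5, Thm. 1.1]") ← Burungale–Disegni AIF 70 (2020) Thm. 1.1 "`p ∤ 2 D_F h_E^−`".
  The `p = 2` case is ASSERTED (abstract; Burungale–Skinner, App. A to arXiv:2210.10730, Rem. 10.5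
  (i) "all these results allow for `p = 2`"; Li–Tian–Yan–Zhu PAMQ 21 (2025) Thm. 1.2 uses it); the
  only written `p = 2`-specific argument is Q. Yu's Caltech senior thesis [52] (unrefereed), and
  Ressler–Yu [47] ("in preparation") has not appeared (arXiv / zbMATH / Crossref, 2026-08-27).
  Nothing in print suggests the statement fails at `p = 2`; the finding concerns the printed PROOF.
What would close `ThmA_at_two` in print: a `p = 2` `Λ`-adic explicit reciprocity law for Heegner
classes on `θ_ψ` (Thm. 5.1 at `2`) + `2`-adic Katz/BDP measures as cited objects + `z_{f,χ}`
non-torsion at `2` — or an independent refereed `2`-converse for `K = ℚ(√−7)`.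

## What is here

* `ThmA_at_two` — Theorem A at `p = 2`, in the vocabulary and with the binders of A140 (the
  conductor hypothesis `DifferentExactlyDividesHeckeConductor` is KEPT although it is automatic on
  this corner: `K = ℚ(√−7)`, `v_7(N_E) = 2`; Summit-side consumers discharge it by
  `X12.differentExactlyDividesHeckeConductor_of_cmFieldDiscrOfJ_eq_neg_seven`).
* `ThmA_odd` — Theorem A at primes `p ≠ 2`.
* `thmA_iff_at_two_and_odd : A140 ↔ ThmA_at_two ∧ ThmA_odd` (proved), and the two projections.
* `thmA_at_two_inParticular` — the "In particular" clause at `p = 2` (rank `1`, `#Ш < ∞`) from the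
  slice + Gross–Zagier–Kolyvagin–Rubin (`hGZK`), as `thmA_inParticular` does for A140.
* `cmFieldDiscrOfJ_eq_neg_seven_and_analyticRank_eq_one_of_thmA_at_two` — the slice spelled out on
  its corner with the Deuring binder DISCHARGED (tree theorem
  `deuring_not_hasUnitRootAt_of_hasCM_of_not_cmSplit_holds`): CM + good ordinary at `2` ⟹
  `d_K = −7`, and then `corank_{ℤ_2} Sel_{2^∞} = 1 ⟹ r_an = 1`.
No instance, no notation, no attribute change; imports: `CMPConverse` + the Deuring discharge.

## References

* [BurungaleCastellaSkinnerTian2022] A. Burungale, F. Castella, C. Skinner, Y. Tian, Ann. Math.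
  Québec 46 (2022) 325–346: Thm. A (p. 326), abstract (p. 325), Rem. C/D (p. 327), Thm. 4.4
  (p. 336), Thm. 5.1 (p. 338), Thm. 6.1 (p. 340), Thm. 7.1 (p. 341), Thm. 8.2 (p. 343), refs [47],
  [52] (p. 346).
* [BurungaleTian2019] A. Burungale, Y. Tian, Invent. Math. 220 (2020) 211–253, Thm. 1.2 (`p > 3`).
* [Darmon2004] H. Darmon, CBMS 101, Thm. 3.22 (Gross–Zagier–Kolyvagin).
* [Lang1987] S. Lang, *Elliptic Functions*, GTM 112, Ch. 13 §4 Thm. 12 (Deuring's criterion).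
-/

noncomputable section

open scoped Classical

open WeierstrassCurve
open Literature.NumberTheory.EllipticCurves Literature.NumberTheory.EllipticCurves.Rank1Residual

namespace Literature.NumberTheory.EllipticCurves.BurungaleCastellaSkinnerTian2022

/-! ### The two halves of Theorem A, named -/

/-- **Burungale–Castella–Skinner–Tian 2022, Theorem A AT `p = 2`** (Ann. Math. Québec 46 (2022),
p. 326; `p = 2` discussed in Rem. D, p. 327): for an elliptic curve `E/ℚ` with complex
multiplication by an order of an imaginary quadratic field `K` (then necessarily `K = ℚ(√−7)`),
whose Hecke character has conductor exactly divisible by `𝔡_K` (transcribed on `N_E` as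
`DifferentExactlyDividesHeckeConductor`, automatic here), with GOOD ORDINARY reduction at `2`:
`corank_{ℤ_2} Sel_{2^∞}(E/ℚ) = 1 ⟹ ord_{s=1} L(E, s) = 1`. Exactly the `p = 2` instance of the
tree's fact `thmA_analyticRank_eq_one_of_selmerCorank_eq_one` (projection `thmA_at_two_of_thmA`),
same binders; named separately because the printed PROOF cites, at Thm. 5.1 (p. 338), Thm. 4.4
(p. 336) and Thm. 7.1 (i) (p. 341), inputs stated for odd `p` only (module docstring; citation desk
`pub/bsd-cited` sheet r06/S5, round C2 R631: GAPPED-BY-CITATION as printed on this slice — a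
statement about the proof's citations, not a claim that the statement fails). Refereed STATEMENT;
no `_holds`. [cite: BurungaleCastellaSkinnerTian2022, Thm. A (p. 326); Rem. D (p. 327); abstract (p. 325)] -/
def ThmA_at_two : Prop :=
  ∀ (W : WeierstrassCurve ℚ) [W.IsElliptic] [W.IsGloballyMinimal] (_hCM : W.HasCM)
    (_hcond : DifferentExactlyDividesHeckeConductor W) [Fact (2 : ℕ).Prime]
    (_hgood : W.HasGoodReductionAtPrime 2) (_hord : ¬ ((2 : ℕ) : ℤ) ∣ W.frobeniusTrace 2)
    (_h : W.selmerCorank 2 = 1), W.analyticRank = 1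

/-- **Burungale–Castella–Skinner–Tian 2022, Theorem A at ODD primes `p`** (p. 326): the same
statement for a prime `p ≠ 2` of good ordinary reduction (`p = 3`: `K ∈ {ℚ(√−2), ℚ(√−11)}`, where
the printed proof has one by-reference extension step, Thm. 6.1 (i) p. 340; `p ≥ 5`: first proved by
Burungale–Tian 2020, tree fact `burungaleTian_analyticRank_eq_one_of_selmerCorank_eq_one_of_hasCM`).
Exactly the `p ≠ 2` instances of `thmA_analyticRank_eq_one_of_selmerCorank_eq_one` (projection
`thmA_odd_of_thmA`). Refereed; no `_holds`.
[cite: BurungaleCastellaSkinnerTian2022, Thm. A (p. 326); Thm. 6.1 (p. 340)] [cite: BurungaleTian2019, Thm. 1.2 (p. 214)] -/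
def ThmA_odd : Prop :=
  ∀ (W : WeierstrassCurve ℚ) [W.IsElliptic] [W.IsGloballyMinimal] (_hCM : W.HasCM)
    (_hcond : DifferentExactlyDividesHeckeConductor W) (p : ℕ) [Fact p.Prime] (_hp : p ≠ 2)
    (_hgood : W.HasGoodReductionAtPrime p) (_hord : ¬ (p : ℤ) ∣ W.frobeniusTrace p)
    (_h : W.selmerCorank p = 1), W.analyticRank = 1

/-! ### The split (proved) -/

/-- Theorem A implies its `p = 2` slice (instantiate at `p = 2`).
[cite: BurungaleCastellaSkinnerTian2022, Thm. A (p. 326)] -/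
theorem thmA_at_two_of_thmA (h : thmA_analyticRank_eq_one_of_selmerCorank_eq_one) :
    ThmA_at_two :=
  fun W _ _ hCM hcond _ hgood hord hc ↦ h W hCM hcond 2 hgood hord hc

/-- Theorem A implies its odd-`p` part (forget `p ≠ 2`).
[cite: BurungaleCastellaSkinnerTian2022, Thm. A (p. 326)] -/
theorem thmA_odd_of_thmA (h : thmA_analyticRank_eq_one_of_selmerCorank_eq_one) : ThmA_odd :=
  fun W _ _ hCM hcond p _ _ hgood hord hc ↦ h W hCM hcond p hgood hord hc

/-- Conversely the two halves give Theorem A back (`by_cases p = 2`).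
[cite: BurungaleCastellaSkinnerTian2022, Thm. A (p. 326)] -/
theorem thmA_of_at_two_of_odd (h2 : ThmA_at_two) (hodd : ThmA_odd) :
    thmA_analyticRank_eq_one_of_selmerCorank_eq_one := by
  intro W _ _ hCM hcond p hp hgood hord hc
  by_cases h : p = 2
  · subst h
    exact h2 W hCM hcond hgood hord hc
  · exact hodd W hCM hcond p h hgood hord hc

/-- **THE SPLIT, kernel-checked: Theorem A (the tree's fact A140) is exactly the conjunction of
its `p = 2` slice and its odd-`p` part.** (Desk sheet r06/S5 §5, re-proved there rc 0.)
[cite: BurungaleCastellaSkinnerTian2022, Thm. A (p. 326)] -/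
theorem thmA_iff_at_two_and_odd :
    thmA_analyticRank_eq_one_of_selmerCorank_eq_one ↔ ThmA_at_two ∧ ThmA_odd :=
  ⟨fun h ↦ ⟨thmA_at_two_of_thmA h, thmA_odd_of_thmA h⟩, fun h ↦ thmA_of_at_two_of_odd h.1 h.2⟩

/-- Given Burungale–Tian 2020 at `p ≥ 5` (tree fact, binder `hBT`), the odd-`p` part of Theorem A
is equivalent to its `p = 3` instance (inlined, not a further name): what `ThmA_odd` adds to the
tree beyond Burungale–Tian is the prime `3` only (p. 326: "For primes `p > 3`, the result was first
proved in [12]"). [cite: BurungaleCastellaSkinnerTian2022, Thm. A and the paragraph before it (p. 326)]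
[cite: BurungaleTian2019, Thm. 1.2 (p. 214)] -/
theorem thmA_odd_iff_three_of_burungaleTian
    (hBT : burungaleTian_analyticRank_eq_one_of_selmerCorank_eq_one_of_hasCM) :
    ThmA_odd ↔
      ∀ (W : WeierstrassCurve ℚ) [W.IsElliptic] [W.IsGloballyMinimal], W.HasCM →
        DifferentExactlyDividesHeckeConductor W → ∀ [Fact (3 : ℕ).Prime],
          W.HasGoodReductionAtPrime 3 → ¬ ((3 : ℕ) : ℤ) ∣ W.frobeniusTrace 3 →
            W.selmerCorank 3 = 1 → W.analyticRank = 1 := by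
  refine ⟨fun h W _ _ hCM hcond _ hgood hord hc ↦ h W hCM hcond 3 (by decide) hgood hord hc,
    fun h W _ _ hCM hcond p _ hp2 hgood hord hc ↦ ?_⟩
  by_cases h3 : p = 3
  · subst h3
    exact h W hCM hcond hgood hord hc
  · have h5 : 5 ≤ p := by
      have hp : p.Prime := Fact.out
      by_contra hlt
      push Not at hlt
      interval_cases p <;> simp_all (config := { decide := true })
    exact hBT W hCM p h5 hgood hord hc

/-! ### The `p = 2` slice on its corner -/

/-- **The "In particular" clause of Theorem A at `p = 2`** (p. 326): from the slice `h2` and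
Gross–Zagier–Kolyvagin–Rubin (`hGZK`, the tree's fact `rank_eq_analyticRank_of_analyticRank_le_one`),
`corank_{ℤ_2} Sel_{2^∞}(E/ℚ) = 1 ⟹ ord_{s=1} L(E,s) = 1 ∧ rank_ℤ E(ℚ) = 1 ∧ #Ш(E/ℚ) < ∞`.
[cite: BurungaleCastellaSkinnerTian2022, Thm. A ("In particular" clause) (p. 326)] [cite: Darmon2004, Thm. 3.22] -/
theorem thmA_at_two_inParticular (h2 : ThmA_at_two)
    (hGZK : rank_eq_analyticRank_of_analyticRank_le_one)
    (W : WeierstrassCurve ℚ) [W.IsElliptic] [W.IsGloballyMinimal] (hCM : W.HasCM)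
    (hcond : DifferentExactlyDividesHeckeConductor W) [Fact (2 : ℕ).Prime]
    (hgood : W.HasGoodReductionAtPrime 2) (hord : ¬ ((2 : ℕ) : ℤ) ∣ W.frobeniusTrace 2)
    (hcorank : W.selmerCorank 2 = 1) :
    W.analyticRank = 1 ∧ W.mordellWeilRank = 1 ∧ Finite W.sha := by
  have h1 : W.analyticRank = 1 := h2 W hCM hcond hgood hord hcorank
  obtain ⟨hrank, hsha⟩ := hGZK W h1.le
  exact ⟨h1, by rw [hrank, h1], hsha⟩

/-- **The slice spelled out on its corner, Deuring DISCHARGED**: a CM curve `E/ℚ` with good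
ordinary reduction at `2` has CM field `ℚ(√−7)` (`d_K = −7`, i.e. `j(E) ∈ {−3375, 16581375}`) — by
`cmFieldDiscrOfJ_eq_of_goodOrd_two` fed with the tree's THEOREM
`deuring_not_hasUnitRootAt_of_hasCM_of_not_cmSplit_holds` (no Deuring binder) — and, granted
`ThmA_at_two` and the transcribed conductor hypothesis, `corank_{ℤ_2} Sel_{2^∞}(E/ℚ) = 1 ⟹
ord_{s=1} L(E, s) = 1`. (Summit-side, `hcond` is itself discharged on this corner:
`X12.differentExactlyDividesHeckeConductor_of_cmFieldDiscrOfJ_eq_neg_seven`.)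
[cite: BurungaleCastellaSkinnerTian2022, Thm. A (p. 326) and Rem. D (p. 327)] [cite: Lang1987, Ch. 13 §4 Thm. 12] -/
theorem cmFieldDiscrOfJ_eq_neg_seven_and_analyticRank_eq_one_of_thmA_at_two (h2 : ThmA_at_two)
    (W : WeierstrassCurve ℚ) [W.IsElliptic] [W.IsGloballyMinimal] (hCM : W.HasCM)
    (hcond : DifferentExactlyDividesHeckeConductor W) [Fact (2 : ℕ).Prime]
    (hgood : W.HasGoodReductionAtPrime 2) (hord : ¬ ((2 : ℕ) : ℤ) ∣ W.frobeniusTrace 2)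
    (hcorank : W.selmerCorank 2 = 1) :
    cmFieldDiscrOfJ W.j = -7 ∧ W.analyticRank = 1 :=
  ⟨cmFieldDiscrOfJ_eq_of_goodOrd_two deuring_not_hasUnitRootAt_of_hasCM_of_not_cmSplit_holds W hCM
    hgood hord, h2 W hCM hcond hgood hord hcorank⟩

end Literature.NumberTheory.EllipticCurves.BurungaleCastellaSkinnerTian2022

end
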